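import Literature.Analysis.FluidPDE.Caccioppoli
import Literature.Analysis.FluidPDE.LaplaceDivFormMollified
import Literature.Analysis.FunctionSpaces.SobolevBallScaling
import HarnessLib

/-!
# `Δw = div F` on a ball: the first (`L⁶`) round and translated radial cut-offs

Analysis/FluidPDE support file (everything proved, no definitions) on the discharge path of the
named fact `Literature.Analysis.FluidPDE.LaplaceDivFormInteriorHolder`
(`NSBoundedSpatialHolder.lean`; Gilbarg–Trudinger 2001, Thm. 8.24 for `L = Δ`, `g = 0`,
`n = 3`). The discharge represents a localisation `χw` of a `W^{1,2}(B_R)` weak solution of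
`Δw = div F` through Newtonian potentials (`LaplaceDivFormMollified.ae_eq_sum_potential`) whose
densities `f'ⱼ = χFⱼ + 2w∂ⱼχ`, `h' = -⟨F, ∇χ⟩ - wΔχ` must lie in `L^p`, `p > 3`, resp. `L²`, with
norms controlled by `‖w‖_{L²(B_R)} + ‖F‖_{L^q(B_R)}` **uniformly in the centre `x₀`**. This file
supplies the two centre-uniform ingredients:

* translated radial cut-offs `x ↦ θ_{r₀,r₁}(x₀ - x)` (`radialCutoff`, `NewtonKernel.lean`):
  smoothness, `= 1` on `B̄(x₀, r₀)`, support in `B̄(x₀, r₁)`, and the facts that their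
  derivative norms and Laplacians are translates of those of the fixed profile
  (`norm_fderiv_cutoff`, `laplacian_cutoff`), so that `sup ‖Dχ‖`, `sup |Δχ|` do not depend on
  `x₀` (`exists_bound_fderiv_radialCutoff`, `exists_bound_laplacian_radialCutoff`);
* **the first round** `exists_eLpNorm_six_le`: for `0 < ρ₁ < R` there is `C = C(ρ₁, R)` with
  `‖w‖_{L⁶(B(x₀,ρ₁))} ≤ C (‖w‖_{L²(B(x₀,R))} + ‖F‖_{L²(B(x₀,R))})` for every centre `x₀` and
  every weak solution — the Caccioppoli inequality of the tree (`Caccioppoli.sq_integral_le`,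
  with the cut-off `θ_{ρ₁,(ρ₁+R)/2}(x₀ - ·)`) bounds `‖Dw‖_{L²(B_{ρ₁})}`
  (`eLpNorm_weakGrad_le`), and the scale-invariant Sobolev inequality on balls
  (`FunctionSpaces.exists_eLpNorm_le_ball`, `p = 2`, `p* = 6`) concludes.

## References

* D. Gilbarg, N. S. Trudinger, *Elliptic Partial Differential Equations of Second Order*,
  Springer Classics in Mathematics (2001), §8.6 and Thm. 8.24. [GilbargTrudinger2001]
* M. Giaquinta, *Multiple integrals in the calculus of variations and nonlinear elliptic
  systems*, Princeton (1983), Ch. III §2 (Caccioppoli and Sobolev on balls). [folklore]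
-/

noncomputable section

open MeasureTheory Set Function Filter Topology TopologicalSpace Metric
open scoped NNReal ENNReal RealInnerProductSpace Laplacian

namespace Literature.Analysis.FluidPDE

/-- Euclidean `ℝ³`. -/
local notation "ℝ³" => EuclideanSpace ℝ (Fin 3)

namespace LaplaceDivFormRoundOne

open SerrinBoundedHolder LaplaceDivFormLocalisation Caccioppoli

/-! ### Generic tools -/

/-- From `L^p` on a set to `L^p`, for functions vanishing off the set (indicator). [folklore] -/
theorem memLp_of_memLp_restrict' {V : Type*} [NormedAddCommGroup V] {f : ℝ³ → V} {s : Set ℝ³}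
    {p : ℝ≥0∞} (hs : MeasurableSet s) (hf : MemLp f p (volume.restrict s))
    (h0 : ∀ x, x ∉ s → f x = 0) : MemLp f p volume := by
  have h : s.indicator f = f := by
    funext x
    by_cases hx : x ∈ s
    · simp [hx]
    · simp [hx, h0 x hx]
  rw [← h]
  exact (memLp_indicator_iff_restrict hs).2 hf

/-- The `L^p` norm of a function vanishing off `s` is its `L^p(s)` norm. [folklore] -/
theorem eLpNorm_eq_eLpNorm_restrict {V : Type*} [NormedAddCommGroup V] {f : ℝ³ → V} {s : Set ℝ³}
    {p : ℝ≥0∞} (hs : MeasurableSet s) (h0 : ∀ x, x ∉ s → f x = 0) :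
    eLpNorm f p volume = eLpNorm f p (volume.restrict s) := by
  have h : s.indicator f = f := by
    funext x
    by_cases hx : x ∈ s
    · simp [hx]
    · simp [hx, h0 x hx]
  rw [← eLpNorm_indicator_eq_eLpNorm_restrict hs, h]

/-- `‖f‖_{L²} = √(∫ ‖f‖²)` for `f ∈ L²`. [folklore] -/
theorem eLpNorm_two_eq_sqrt {V : Type*} [NormedAddCommGroup V] {μ : Measure ℝ³} {f : ℝ³ → V}
    (hf : MemLp f 2 μ) : eLpNorm f 2 μ = ENNReal.ofReal (Real.sqrt (∫ x, ‖f x‖ ^ 2 ∂μ)) := by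
  rw [hf.eLpNorm_eq_integral_rpow_norm two_ne_zero ENNReal.ofNat_ne_top]
  simp only [ENNReal.toReal_ofNat, Real.rpow_two, Real.sqrt_eq_rpow, one_div]

/-! ### Translated radial cut-offs `x ↦ θ_{r₀,r₁}(x₀ - x)` -/

section Cutoff

variable {r₀ r₁ : ℝ}

/-- The translated cut-off is smooth. [folklore] -/
theorem contDiff_cutoff (r₀ r₁ : ℝ) (x₀ : ℝ³) {n : ℕ∞} :
    ContDiff ℝ n (fun x : ℝ³ => radialCutoff r₀ r₁ (x₀ - x)) :=
  (radialCutoff_contDiff r₀ r₁).comp (contDiff_const.sub contDiff_id)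

/-- `= 1` on the closed ball `B̄(x₀, r₀)`. [folklore] -/
theorem cutoff_eq_one (h₀ : 0 ≤ r₀) (h₁ : r₀ < r₁) {x₀ x : ℝ³} (hx : x ∈ closedBall x₀ r₀) :
    radialCutoff r₀ r₁ (x₀ - x) = 1 :=
  radialCutoff_eq_one h₀ h₁ (by rwa [mem_closedBall, dist_comm, dist_eq_norm] at hx)

/-- `= 0` off the open ball `B(x₀, r₁)`. [folklore] -/
theorem cutoff_eq_zero (h₀ : 0 ≤ r₀) (h₁ : r₀ < r₁) {x₀ x : ℝ³} (hx : r₁ ≤ dist x x₀) :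
    radialCutoff r₀ r₁ (x₀ - x) = 0 :=
  radialCutoff_eq_zero h₀ h₁ (by rwa [dist_comm, dist_eq_norm] at hx)

/-- `|θ(x₀ - x)| ≤ 1`. [folklore] -/
theorem abs_cutoff_le_one (r₀ r₁ : ℝ) (x₀ x : ℝ³) : |radialCutoff r₀ r₁ (x₀ - x)| ≤ 1 :=
  abs_radialCutoff_le_one _ _ _

/-- The support lies in `B̄(x₀, r₁)`. [folklore] -/
theorem tsupport_cutoff_subset (h₀ : 0 ≤ r₀) (h₁ : r₀ < r₁) (x₀ : ℝ³) :
    tsupport (fun x : ℝ³ => radialCutoff r₀ r₁ (x₀ - x)) ⊆ closedBall x₀ r₁ := by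
  refine closure_minimal (fun x hx => ?_) isClosed_closedBall
  rw [mem_closedBall]
  by_contra h
  exact hx (cutoff_eq_zero h₀ h₁ (not_le.1 h).le)

/-- The support lies in every larger open ball. [folklore] -/
theorem tsupport_cutoff_subset_ball (h₀ : 0 ≤ r₀) (h₁ : r₀ < r₁) {ρ : ℝ} (hρ : r₁ < ρ)
    (x₀ : ℝ³) : tsupport (fun x : ℝ³ => radialCutoff r₀ r₁ (x₀ - x)) ⊆ ball x₀ ρ :=
  (tsupport_cutoff_subset h₀ h₁ x₀).trans (closedBall_subset_ball hρ)

/-- Compact support. [folklore] -/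
theorem hasCompactSupport_cutoff (h₀ : 0 ≤ r₀) (h₁ : r₀ < r₁) (x₀ : ℝ³) :
    HasCompactSupport (fun x : ℝ³ => radialCutoff r₀ r₁ (x₀ - x)) :=
  (isCompact_closedBall x₀ r₁).of_isClosed_subset (isClosed_tsupport _)
    (tsupport_cutoff_subset h₀ h₁ x₀)

/-- The translated cut-off is a test function on every larger ball. [folklore] -/
theorem isTestFunctionOn_cutoff (h₀ : 0 ≤ r₀) (h₁ : r₀ < r₁) {ρ : ℝ} (hρ : r₁ < ρ) (x₀ : ℝ³) :
    FunctionSpaces.IsTestFunctionOn (⟨ball x₀ ρ, isOpen_ball⟩ : Opens ℝ³)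
      (fun x : ℝ³ => radialCutoff r₀ r₁ (x₀ - x)) :=
  ⟨contDiff_cutoff r₀ r₁ x₀, hasCompactSupport_cutoff h₀ h₁ x₀,
    tsupport_cutoff_subset_ball h₀ h₁ hρ x₀⟩

/-- Off the closed ball the cut-off vanishes together with its derivative and Laplacian.
[folklore] -/
theorem not_mem_tsupport_cutoff (h₀ : 0 ≤ r₀) (h₁ : r₀ < r₁) {x₀ x : ℝ³} (hx : r₁ < dist x x₀) :
    x ∉ tsupport (fun x : ℝ³ => radialCutoff r₀ r₁ (x₀ - x)) := fun h => by
  have := tsupport_cutoff_subset h₀ h₁ x₀ h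
  rw [mem_closedBall] at this
  linarith

/-- `D(θ(x₀ - ·))(x) v = -Dθ(x₀ - x) v`. [folklore] -/
theorem fderiv_cutoff_apply (r₀ r₁ : ℝ) (x₀ x v : ℝ³) :
    fderiv ℝ (fun x : ℝ³ => radialCutoff r₀ r₁ (x₀ - x)) x v =
      -(fderiv ℝ (radialCutoff r₀ r₁ : ℝ³ → ℝ) (x₀ - x) v) :=
  FunctionSpaces.fderiv_comp_sub_left_apply
    (by exact_mod_cast (radialCutoff_contDiff r₀ r₁ (n := 1) (E' := ℝ³))) x₀ x v

/-- `‖D(θ(x₀ - ·))(x)‖ = ‖Dθ(x₀ - x)‖`. [folklore] -/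
theorem norm_fderiv_cutoff (r₀ r₁ : ℝ) (x₀ x : ℝ³) :
    ‖fderiv ℝ (fun x : ℝ³ => radialCutoff r₀ r₁ (x₀ - x)) x‖ =
      ‖fderiv ℝ (radialCutoff r₀ r₁ : ℝ³ → ℝ) (x₀ - x)‖ := by
  have : fderiv ℝ (fun x : ℝ³ => radialCutoff r₀ r₁ (x₀ - x)) x =
      -(fderiv ℝ (radialCutoff r₀ r₁ : ℝ³ → ℝ) (x₀ - x)) :=
    ContinuousLinearMap.ext fun v => by
      rw [fderiv_cutoff_apply, neg_apply]
  rw [this, norm_neg]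

/-- `Δ(θ(x₀ - ·))(x) = (Δθ)(x₀ - x)`. [folklore] -/
theorem laplacian_cutoff (r₀ r₁ : ℝ) (x₀ x : ℝ³) :
    (Δ (fun x : ℝ³ => radialCutoff r₀ r₁ (x₀ - x))) x =
      (Δ (radialCutoff r₀ r₁ : ℝ³ → ℝ)) (x₀ - x) :=
  laplacian_comp_sub_left (by exact_mod_cast (radialCutoff_contDiff r₀ r₁ (n := 2) (E' := ℝ³)))
    x₀ x

/-- A centre-independent bound for the derivative of the cut-off. [folklore] -/
theorem exists_bound_fderiv_radialCutoff (h₀ : 0 ≤ r₀) (h₁ : r₀ < r₁) :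
    ∃ K : ℝ, 0 ≤ K ∧ ∀ z : ℝ³, ‖fderiv ℝ (radialCutoff r₀ r₁ : ℝ³ → ℝ) z‖ ≤ K := by
  have hd : ContDiff ℝ 1 (radialCutoff r₀ r₁ : ℝ³ → ℝ) := by
    exact_mod_cast (radialCutoff_contDiff r₀ r₁ (n := 1) (E' := ℝ³))
  have hc : Continuous (fderiv ℝ (radialCutoff r₀ r₁ : ℝ³ → ℝ)) := hd.continuous_fderiv one_ne_zero
  have hs : HasCompactSupport (fderiv ℝ (radialCutoff r₀ r₁ : ℝ³ → ℝ)) :=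
    (hasCompactSupport_radialCutoff h₀ h₁).fderiv (𝕜 := ℝ)
  obtain ⟨K, hK⟩ := hc.bounded_above_of_compact_support hs
  exact ⟨max K 0, le_max_right _ _, fun z => (hK z).trans (le_max_left _ _)⟩

/-- A centre-independent bound for the Laplacian of the cut-off. [folklore] -/
theorem exists_bound_laplacian_radialCutoff (h₀ : 0 ≤ r₀) (h₁ : r₀ < r₁) :
    ∃ K : ℝ, 0 ≤ K ∧ ∀ z : ℝ³, |(Δ (radialCutoff r₀ r₁ : ℝ³ → ℝ)) z| ≤ K := by
  have hd : ContDiff ℝ ((0 : ℕ∞) + 2) (radialCutoff r₀ r₁ : ℝ³ → ℝ) := by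
    exact_mod_cast (radialCutoff_contDiff r₀ r₁ (n := 2) (E' := ℝ³))
  have hc : Continuous (Δ (radialCutoff r₀ r₁ : ℝ³ → ℝ)) :=
    (contDiff_laplacian (n := 0) hd).continuous
  have hs : HasCompactSupport (Δ (radialCutoff r₀ r₁ : ℝ³ → ℝ)) :=
    HasCompactSupport.intro (hasCompactSupport_radialCutoff h₀ h₁)
      fun z hz => laplacian_eq_zero_of_notMem_tsupport hz
  obtain ⟨K, hK⟩ := hc.bounded_above_of_compact_support hs
  refine ⟨max K 0, le_max_right _ _, fun z => ?_⟩
  have := hK z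
  rw [Real.norm_eq_abs] at this
  exact this.trans (le_max_left _ _)

/-- The derivative bound, transported to the translated cut-off. [folklore] -/
theorem norm_fderiv_cutoff_le {K : ℝ} (hK : ∀ z : ℝ³, ‖fderiv ℝ (radialCutoff r₀ r₁ : ℝ³ → ℝ) z‖ ≤ K)
    (x₀ x : ℝ³) : ‖fderiv ℝ (fun x : ℝ³ => radialCutoff r₀ r₁ (x₀ - x)) x‖ ≤ K := by
  rw [norm_fderiv_cutoff]
  exact hK _

/-- The directional-derivative bound for the translated cut-off. [folklore] -/
theorem abs_fderiv_cutoff_apply_single_le {K : ℝ}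
    (hK : ∀ z : ℝ³, ‖fderiv ℝ (radialCutoff r₀ r₁ : ℝ³ → ℝ) z‖ ≤ K) (x₀ x : ℝ³) (j : Fin 3) :
    |fderiv ℝ (fun x : ℝ³ => radialCutoff r₀ r₁ (x₀ - x)) x (EuclideanSpace.single j (1 : ℝ))| ≤
      K := by
  rw [← Real.norm_eq_abs]
  refine (ContinuousLinearMap.le_opNorm _ _).trans ?_
  have : ‖(EuclideanSpace.single j (1 : ℝ) : ℝ³)‖ = 1 := by simp
  rw [this, mul_one]
  exact norm_fderiv_cutoff_le hK x₀ x

/-- The Laplacian bound, transported to the translated cut-off. [folklore] -/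
theorem abs_laplacian_cutoff_le {K : ℝ} (hK : ∀ z : ℝ³, |(Δ (radialCutoff r₀ r₁ : ℝ³ → ℝ)) z| ≤ K)
    (x₀ x : ℝ³) : |(Δ (fun x : ℝ³ => radialCutoff r₀ r₁ (x₀ - x))) x| ≤ K := by
  rw [laplacian_cutoff]
  exact hK _

end Cutoff

/-! ### The first round: `‖Dw‖_{L²(B_{ρ₁})}` and `‖w‖_{L⁶(B_{ρ₁})}` -/

section RoundOne

variable {x₀ : ℝ³} {R : ℝ} {w : ℝ³ → ℝ} {g : ℝ³ → ℝ³ →L[ℝ] ℝ} {F : ℝ³ → ℝ³}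

/-- **Interior `L²` gradient bound.** For a `W^{1,2}(B_R)` weak solution of `Δw = div F` with
`F ∈ L²(B_R)` and `0 < ρ₁ < c < R`:
`∫_{B_{ρ₁}} ‖Dw‖² ≤ 10 K² ∫_{B_R} w² + 4 ∫_{B_R} ‖F‖²`, `K = sup ‖Dθ_{ρ₁,c}‖`
(Caccioppoli with the cut-off `θ_{ρ₁,c}(x₀ - ·)`). [folklore] -/
theorem sq_integral_weakGrad_le
    (hw : FunctionSpaces.HasWeakFDerivOn (⟨ball x₀ R, isOpen_ball⟩ : Opens ℝ³) volume w g)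
    (hw2 : MemLp w 2 (volume.restrict (ball x₀ R)))
    (hg2 : MemLp g 2 (volume.restrict (ball x₀ R)))
    (hF2 : MemLp F 2 (volume.restrict (ball x₀ R)))
    (heq : ∀ φ : ℝ³ → ℝ, FunctionSpaces.IsTestFunctionOn (⟨ball x₀ R, isOpen_ball⟩ : Opens ℝ³) φ →
      ∫ x in ball x₀ R, g x (gradient φ x) = ∫ x in ball x₀ R, ⟪F x, gradient φ x⟫)
    {ρ₁ c : ℝ} (h0 : 0 < ρ₁) (h1 : ρ₁ < c) (h2 : c < R) {K : ℝ}
    (hK : ∀ z : ℝ³, ‖fderiv ℝ (radialCutoff ρ₁ c : ℝ³ → ℝ) z‖ ≤ K) :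
    ∫ x in ball x₀ ρ₁, ‖g x‖ ^ 2 ≤
      10 * K ^ 2 * (∫ x in ball x₀ R, w x ^ 2) + 4 * ∫ x in ball x₀ R, ‖F x‖ ^ 2 := by
  have hηs : tsupport (fun x : ℝ³ => radialCutoff ρ₁ c (x₀ - x)) ⊆ ball x₀ R :=
    tsupport_cutoff_subset_ball h0.le h1 h2 x₀
  have hηc := hasCompactSupport_cutoff h0.le h1 x₀
  have hηd : ContDiff ℝ (⊤ : ℕ∞) (fun x : ℝ³ => radialCutoff ρ₁ c (x₀ - x)) :=
    contDiff_cutoff ρ₁ c x₀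
  have I := sq_integral_le hw hw2 hg2 hF2 heq hηd hηc hηs
  have hK0 : 0 ≤ K := (norm_nonneg _).trans (hK 0)
  have hηK : ∀ x, ‖fderiv ℝ (fun x : ℝ³ => radialCutoff ρ₁ c (x₀ - x)) x‖ ≤ K :=
    norm_fderiv_cutoff_le hK x₀
  have hη1 : ∀ x : ℝ³, (radialCutoff ρ₁ c (x₀ - x)) ^ 2 ≤ 1 := fun x => by
    rw [← sq_abs]
    exact pow_le_one₀ (abs_nonneg _) (abs_cutoff_le_one _ _ _ _)
  -- integrability on `B_R`
  have iw2 : IntegrableOn (fun x => w x ^ 2) (ball x₀ R) volume := by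
    have := hw2.integrable_norm_pow two_ne_zero
    refine this.congr (Eventually.of_forall fun x => ?_)
    simp only [Real.norm_eq_abs, sq_abs]
  have iF2 : IntegrableOn (fun x => ‖F x‖ ^ 2) (ball x₀ R) volume :=
    hF2.integrable_norm_pow two_ne_zero
  have ig2 : IntegrableOn (fun x => ‖g x‖ ^ 2) (ball x₀ R) volume :=
    hg2.integrable_norm_pow two_ne_zero
  have iηg : IntegrableOn (fun x => (radialCutoff ρ₁ c (x₀ - x)) ^ 2 * ‖g x‖ ^ 2) (ball x₀ R)
      volume := by
    refine Integrable.bdd_mul (c := 1) ig2 ?_ (Eventually.of_forall fun x => ?_)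
    · exact ((contDiff_cutoff ρ₁ c x₀ (n := 0)).continuous.pow 2).aestronglyMeasurable
    · rw [Real.norm_eq_abs, abs_of_nonneg (sq_nonneg _)]
      exact hη1 x
  -- left-hand side
  have hsub : ball x₀ ρ₁ ⊆ ball x₀ R := ball_subset_ball (h1.le.trans h2.le)
  have hL : ∫ x in ball x₀ ρ₁, ‖g x‖ ^ 2 ≤
      ∫ x in ball x₀ R, (radialCutoff ρ₁ c (x₀ - x)) ^ 2 * ‖g x‖ ^ 2 := by
    calc ∫ x in ball x₀ ρ₁, ‖g x‖ ^ 2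
        = ∫ x in ball x₀ ρ₁, (radialCutoff ρ₁ c (x₀ - x)) ^ 2 * ‖g x‖ ^ 2 := by
          refine setIntegral_congr_fun measurableSet_ball fun x hx => ?_
          simp only [cutoff_eq_one h0.le h1 (ball_subset_closedBall hx), one_pow, one_mul]
      _ ≤ ∫ x in ball x₀ R, (radialCutoff ρ₁ c (x₀ - x)) ^ 2 * ‖g x‖ ^ 2 :=
          setIntegral_mono_set iηg
            (Eventually.of_forall fun x => by simp only [Pi.zero_apply]; positivity)
            hsub.eventuallyLE
  -- right-hand side
  have hR1 : ∫ x in ball x₀ R, w x ^ 2 *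
      ‖fderiv ℝ (fun x : ℝ³ => radialCutoff ρ₁ c (x₀ - x)) x‖ ^ 2 ≤
      K ^ 2 * ∫ x in ball x₀ R, w x ^ 2 := by
    rw [← integral_const_mul]
    refine integral_mono_of_nonneg (Eventually.of_forall fun x => by positivity) (iw2.const_mul _)
      (Eventually.of_forall fun x => ?_)
    have h := hηK x
    calc w x ^ 2 * ‖fderiv ℝ (fun x : ℝ³ => radialCutoff ρ₁ c (x₀ - x)) x‖ ^ 2
        ≤ w x ^ 2 * K ^ 2 :=
          mul_le_mul_of_nonneg_left (pow_le_pow_left₀ (norm_nonneg _) h 2) (sq_nonneg _)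
      _ = K ^ 2 * w x ^ 2 := mul_comm _ _
  have hR2 : ∫ x in ball x₀ R, (radialCutoff ρ₁ c (x₀ - x)) ^ 2 * ‖F x‖ ^ 2 ≤
      ∫ x in ball x₀ R, ‖F x‖ ^ 2 := by
    refine integral_mono_of_nonneg (Eventually.of_forall fun x => by positivity) iF2
      (Eventually.of_forall fun x => ?_)
    calc (radialCutoff ρ₁ c (x₀ - x)) ^ 2 * ‖F x‖ ^ 2 ≤ 1 * ‖F x‖ ^ 2 :=
          mul_le_mul_of_nonneg_right (hη1 x) (sq_nonneg _)
      _ = ‖F x‖ ^ 2 := one_mul _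
  calc ∫ x in ball x₀ ρ₁, ‖g x‖ ^ 2 ≤ _ := hL
    _ ≤ _ := I
    _ ≤ 10 * (K ^ 2 * ∫ x in ball x₀ R, w x ^ 2) + 4 * ∫ x in ball x₀ R, ‖F x‖ ^ 2 := by
        gcongr
    _ = _ := by ring

/-- The same bound for the `L²` norms:
`‖Dw‖_{L²(B_{ρ₁})} ≤ √10 K ‖w‖_{L²(B_R)} + 2‖F‖_{L²(B_R)}`. [folklore] -/
theorem eLpNorm_weakGrad_le
    (hw : FunctionSpaces.HasWeakFDerivOn (⟨ball x₀ R, isOpen_ball⟩ : Opens ℝ³) volume w g)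
    (hw2 : MemLp w 2 (volume.restrict (ball x₀ R)))
    (hg2 : MemLp g 2 (volume.restrict (ball x₀ R)))
    (hF2 : MemLp F 2 (volume.restrict (ball x₀ R)))
    (heq : ∀ φ : ℝ³ → ℝ, FunctionSpaces.IsTestFunctionOn (⟨ball x₀ R, isOpen_ball⟩ : Opens ℝ³) φ →
      ∫ x in ball x₀ R, g x (gradient φ x) = ∫ x in ball x₀ R, ⟪F x, gradient φ x⟫)
    {ρ₁ c : ℝ} (h0 : 0 < ρ₁) (h1 : ρ₁ < c) (h2 : c < R) {K : ℝ}
    (hK : ∀ z : ℝ³, ‖fderiv ℝ (radialCutoff ρ₁ c : ℝ³ → ℝ) z‖ ≤ K) :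
    eLpNorm g 2 (volume.restrict (ball x₀ ρ₁)) ≤
      ENNReal.ofReal (Real.sqrt 10 * K) * eLpNorm w 2 (volume.restrict (ball x₀ R)) +
        2 * eLpNorm F 2 (volume.restrict (ball x₀ R)) := by
  have I := sq_integral_weakGrad_le hw hw2 hg2 hF2 heq h0 h1 h2 hK
  have hK0 : 0 ≤ K := (norm_nonneg _).trans (hK 0)
  have hsub : ball x₀ ρ₁ ⊆ ball x₀ R := ball_subset_ball (h1.le.trans h2.le)
  have hg2' : MemLp g 2 (volume.restrict (ball x₀ ρ₁)) :=
    hg2.mono_measure (Measure.restrict_mono hsub le_rfl)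
  have hIw : 0 ≤ ∫ x in ball x₀ R, w x ^ 2 := integral_nonneg fun x => sq_nonneg _
  have hIF : 0 ≤ ∫ x in ball x₀ R, ‖F x‖ ^ 2 := integral_nonneg fun x => by positivity
  have e_w : eLpNorm w 2 (volume.restrict (ball x₀ R)) =
      ENNReal.ofReal (Real.sqrt (∫ x in ball x₀ R, w x ^ 2)) := by
    rw [eLpNorm_two_eq_sqrt hw2]
    congr 2
    refine integral_congr_ae (Eventually.of_forall fun x => ?_)
    simp only [Real.norm_eq_abs, sq_abs]
  rw [eLpNorm_two_eq_sqrt hg2', e_w, eLpNorm_two_eq_sqrt hF2]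
  have h1' : Real.sqrt (∫ x in ball x₀ ρ₁, ‖g x‖ ^ 2) ≤
      Real.sqrt 10 * K * Real.sqrt (∫ x in ball x₀ R, w x ^ 2) +
        2 * Real.sqrt (∫ x in ball x₀ R, ‖F x‖ ^ 2) := by
    calc Real.sqrt (∫ x in ball x₀ ρ₁, ‖g x‖ ^ 2)
        ≤ Real.sqrt (10 * K ^ 2 * (∫ x in ball x₀ R, w x ^ 2) + 4 * ∫ x in ball x₀ R, ‖F x‖ ^ 2) :=
          Real.sqrt_le_sqrt I
      _ ≤ Real.sqrt (10 * K ^ 2 * ∫ x in ball x₀ R, w x ^ 2) +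
            Real.sqrt (4 * ∫ x in ball x₀ R, ‖F x‖ ^ 2) :=
          by
            -- `√(a + b) ≤ √a + √b`
            have ha : (0 : ℝ) ≤ 10 * K ^ 2 * ∫ x in ball x₀ R, w x ^ 2 := by positivity
            have hb : (0 : ℝ) ≤ 4 * ∫ x in ball x₀ R, ‖F x‖ ^ 2 := by positivity
            rw [Real.sqrt_le_left (by positivity)]
            nlinarith [Real.sq_sqrt ha, Real.sq_sqrt hb,
              Real.sqrt_nonneg (10 * K ^ 2 * ∫ x in ball x₀ R, w x ^ 2),
              Real.sqrt_nonneg (4 * ∫ x in ball x₀ R, ‖F x‖ ^ 2)]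
      _ = _ := by
          rw [Real.sqrt_mul (by positivity) (∫ x in ball x₀ R, w x ^ 2),
            Real.sqrt_mul (by norm_num) (∫ x in ball x₀ R, ‖F x‖ ^ 2),
            Real.sqrt_mul (by norm_num) (K ^ 2), Real.sqrt_sq hK0,
            show Real.sqrt 4 = 2 by
              rw [show (4 : ℝ) = 2 ^ 2 by norm_num, Real.sqrt_sq zero_le_two]]
  calc ENNReal.ofReal (Real.sqrt (∫ x in ball x₀ ρ₁, ‖g x‖ ^ 2))
      ≤ ENNReal.ofReal (Real.sqrt 10 * K * Real.sqrt (∫ x in ball x₀ R, w x ^ 2) +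
          2 * Real.sqrt (∫ x in ball x₀ R, ‖F x‖ ^ 2)) := ENNReal.ofReal_le_ofReal h1'
    _ = _ := by
        rw [ENNReal.ofReal_add (by positivity) (by positivity),
          ENNReal.ofReal_mul (p := Real.sqrt 10 * K) (by positivity),
          ENNReal.ofReal_mul (p := 2) (by norm_num), ENNReal.ofReal_ofNat]

/-- **The first round (`L⁶` bound, centre-uniform).** For `0 < ρ₁ < R` there is
`C = C(ρ₁, R)` such that every `W^{1,2}(B(x₀,R))` weak solution of `Δw = div F` with
`F ∈ L²(B(x₀,R))` satisfies `‖w‖_{L⁶(B(x₀,ρ₁))} ≤ C (‖w‖_{L²(B(x₀,R))} + ‖F‖_{L²(B(x₀,R))})`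
(Caccioppoli + the scale-invariant Sobolev inequality on balls, `p = 2`, `p* = 6`).
[folklore] -/
theorem exists_eLpNorm_six_le {ρ₁ R : ℝ} (h0 : 0 < ρ₁) (h1 : ρ₁ < R) :
    ∃ C : ℝ≥0, ∀ (x₀ : ℝ³) (w : ℝ³ → ℝ) (g : ℝ³ → ℝ³ →L[ℝ] ℝ) (F : ℝ³ → ℝ³),
      FunctionSpaces.HasWeakFDerivOn (⟨ball x₀ R, isOpen_ball⟩ : Opens ℝ³) volume w g →
      MemLp w 2 (volume.restrict (ball x₀ R)) → MemLp g 2 (volume.restrict (ball x₀ R)) →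
      MemLp F 2 (volume.restrict (ball x₀ R)) →
      (∀ φ : ℝ³ → ℝ, FunctionSpaces.IsTestFunctionOn (⟨ball x₀ R, isOpen_ball⟩ : Opens ℝ³) φ →
        ∫ x in ball x₀ R, g x (gradient φ x) = ∫ x in ball x₀ R, ⟪F x, gradient φ x⟫) →
      eLpNorm w 6 (volume.restrict (ball x₀ ρ₁)) ≤
        C * (eLpNorm w 2 (volume.restrict (ball x₀ R)) +
          eLpNorm F 2 (volume.restrict (ball x₀ R))) := by
  -- the Sobolev constant on balls (`p = 2`, `p* = 6`, `n = 3`)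
  obtain ⟨CS, hCS⟩ := FunctionSpaces.exists_eLpNorm_le_ball (E := ℝ³) (F := ℝ) (p := 2) (p' := 6)
    one_le_two (by rw [finrank_euclideanSpace_fin]; norm_num)
    (by rw [finrank_euclideanSpace_fin]; norm_num)
  -- the cut-off constant
  have h1' : ρ₁ < (ρ₁ + R) / 2 := by linarith
  have h2 : (ρ₁ + R) / 2 < R := by linarith
  obtain ⟨K, hK0, hK⟩ := exists_bound_fderiv_radialCutoff (r₀ := ρ₁) (r₁ := (ρ₁ + R) / 2) h0.le h1'
  set A : ℝ≥0∞ := (ENNReal.ofReal ρ₁)⁻¹ + ENNReal.ofReal (Real.sqrt 10 * K) with hA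
  have hA' : A ≠ ⊤ := by
    rw [hA]
    exact ENNReal.add_ne_top.2
      ⟨ENNReal.inv_ne_top.2 (by simpa using h0), ENNReal.ofReal_ne_top⟩
  refine ⟨CS * (A.toNNReal + 2), fun x₀ w g F hw hw2 hg2 hF2 heq => ?_⟩
  have hsub : ball x₀ ρ₁ ⊆ ball x₀ R := ball_subset_ball h1.le
  have hw' : FunctionSpaces.HasWeakFDerivOn (⟨ball x₀ ρ₁, isOpen_ball⟩ : Opens ℝ³) volume w g :=
    FunctionSpaces.HasWeakFDerivOn.mono_set_holds hw
      (show ((⟨ball x₀ ρ₁, isOpen_ball⟩ : Opens ℝ³) : Set ℝ³) ⊆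
        ((⟨ball x₀ R, isOpen_ball⟩ : Opens ℝ³) : Set ℝ³) from hsub)
  have hμ : volume.restrict (ball x₀ ρ₁) ≤ volume.restrict (ball x₀ R) :=
    Measure.restrict_mono hsub le_rfl
  have hw2' : MemLp w 2 (volume.restrict (ball x₀ ρ₁)) := hw2.mono_measure hμ
  have hg2' : MemLp g 2 (volume.restrict (ball x₀ ρ₁)) := hg2.mono_measure hμ
  have hsob : FunctionSpaces.MemSobolevDomain 1 ((2 : ℝ≥0) : ℝ≥0∞)
      (⟨ball x₀ ρ₁, isOpen_ball⟩ : Opens ℝ³) volume w := by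
    refine FunctionSpaces.memSobolevDomain_succ_iff.2 ⟨by exact_mod_cast hw2', g, hw', fun v => ?_⟩
    rw [FunctionSpaces.memSobolevDomain_zero_iff]
    exact_mod_cast (ContinuousLinearMap.apply ℝ ℝ v).comp_memLp' hg2'
  have hS := hCS x₀ ρ₁ h0 w g hsob hw'
  have hS' : eLpNorm w 6 (volume.restrict (ball x₀ ρ₁)) ≤
      CS * ((ENNReal.ofReal ρ₁)⁻¹ * eLpNorm w 2 (volume.restrict (ball x₀ ρ₁)) +
        eLpNorm g 2 (volume.restrict (ball x₀ ρ₁))) := by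
    exact_mod_cast hS
  have hG := eLpNorm_weakGrad_le hw hw2 hg2 hF2 heq h0 h1' h2 hK
  have hwm : eLpNorm w 2 (volume.restrict (ball x₀ ρ₁)) ≤
      eLpNorm w 2 (volume.restrict (ball x₀ R)) := eLpNorm_mono_measure w hμ
  calc eLpNorm w 6 (volume.restrict (ball x₀ ρ₁)) ≤ _ := hS'
    _ ≤ CS * ((ENNReal.ofReal ρ₁)⁻¹ * eLpNorm w 2 (volume.restrict (ball x₀ R)) +
          (ENNReal.ofReal (Real.sqrt 10 * K) * eLpNorm w 2 (volume.restrict (ball x₀ R)) +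
            2 * eLpNorm F 2 (volume.restrict (ball x₀ R)))) :=
        mul_le_mul_right (add_le_add (mul_le_mul_right hwm _) hG) _
    _ = CS * (A * eLpNorm w 2 (volume.restrict (ball x₀ R)) +
          2 * eLpNorm F 2 (volume.restrict (ball x₀ R))) := by
        rw [hA]
        ring
    _ ≤ ((CS * (A.toNNReal + 2) : ℝ≥0) : ℝ≥0∞) *
          (eLpNorm w 2 (volume.restrict (ball x₀ R)) +
            eLpNorm F 2 (volume.restrict (ball x₀ R))) := by
        rw [ENNReal.coe_mul, ENNReal.coe_add, ENNReal.coe_toNNReal hA', mul_assoc]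
        push_cast
        refine mul_le_mul_right ?_ _
        calc A * eLpNorm w 2 (volume.restrict (ball x₀ R)) +
              2 * eLpNorm F 2 (volume.restrict (ball x₀ R))
            ≤ (A + 2) * eLpNorm w 2 (volume.restrict (ball x₀ R)) +
                (A + 2) * eLpNorm F 2 (volume.restrict (ball x₀ R)) :=
              add_le_add (mul_le_mul_left le_self_add _) (mul_le_mul_left le_add_self _)
          _ = (A + 2) * (eLpNorm w 2 (volume.restrict (ball x₀ R)) +
                eLpNorm F 2 (volume.restrict (ball x₀ R))) := (mul_add _ _ _).symm

end RoundOne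

end LaplaceDivFormRoundOne

end Literature.Analysis.FluidPDE
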